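import Summits.CriticalPhenomena.Ising3DConformalLimit.Theses.ReflectionTwin
import Summits.CriticalPhenomena.Ising3DConformalLimit.Theorems.HyperoctahedralRPExistsScaleCovariantLimitDecimationTwoCouplingGKS
import Literature.Barriers.CriticalPhenomena.LaceExpansionIsingAboveFourProofs
import HarnessLib

/-!
# Stub `stub_thresholdNotCut` of line `replica-mirror` (crux `ReflectionTwin.TwinTransparency`, stmt-CriticalPhenomena-16905)

A CONTINUOUS PLANE-ORDERING THRESHOLD OF THE (111) REFLECTION TWIN IS PLANE-CRITICAL (theorem `ThresholdNotCut`
of idea `threshold-lebowitz-calculus`). The twin `TW(J)` on the cube `Λ_L = box 3 L` has the pair couplings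
`β_c(3)/2` on the lattice bonds not joining the layers `h = 0, 1` (`h z = z₀ + z₁ + z₂`) and on the twin bonds,
multiplied by the seam coupling `J` on every bond touching the plane `h = 0`. With the slab `T = {|h| ≤ 1}`, the
free-box pair correlations `⟨σ_aσ_b⟩_{L,J}`, their sup over boxes `twinLat`, the slab sums
`χ_a(J) = Σ_{b ∈ T ∩ Λ_L} ⟨σ_aσ_b⟩_{L,J}` and the slab susceptibility `slabChi J = sup_x Σ'_y twinLat J (x,y) ∈ [0,∞]`
(`x, y ∈ T`): if `J* > 0` has plane long-range order at every `J' > J*`, then `slabChi J* = ⊤`. The registered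
signature takes the Griffiths monotonicity package S1 (`stub_twinBoxMonotone`) and the finite-volume Lebowitz
increment S2 (`stub_seamLebowitzIncrement`) as hypotheses; only the clause `∀ J' > J*, LRO J'` (and `0 < J*`) of the
threshold is used.

Proof (finite susceptibility is an open condition in `J`; Aizenman–Newman 1984 / Glimm–Jaffe §4.2 style).
Suppose `slabChi J < ⊤`, `χ := (slabChi J).toReal`. (1) Every box slab sum is below `χ` (each box correlation is
below its sup over boxes, S1(c); finite sums are below the `tsum`, which is below the `iSup`). (2) The box maximum
`M_L(t) = max_{a ∈ T ∩ Λ_L} χ_a(t)` is `≥ 1` (diagonal term, GKS I), non-decreasing in `t ≥ 0` (GKS II = S1(b)) and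
satisfies the increment bound of S2 with `M = M_L(t)`; the partition lemma `inv_sub_inv_le_of_increment`
(`Literature/Barriers/CriticalPhenomena/LaceExpansionIsingAboveFourProofs.lean`) gives
`M_L(J)⁻¹ - M_L(J+ε)⁻¹ ≤ 12 β_c ε`, hence with `B ≥ max(χ,1)` and `12 β_c ε ≤ B⁻¹/2`: `M_L(J+ε) ≤ 2B` for EVERY `L`.
(3) Plane long-range order at `J + ε` gives `m > 0` below `twinLat (0, c)` for all plane sites `c`; for `N` plane sites
`(n,-n,0)` with `N m / 2 > 2B`, pick boxes where each box correlation exceeds `m/2` (`exists_lt_of_lt_ciSup`), go to a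
common larger box (volume monotonicity S1(a)) and bound the slab sum of the origin from below by `N m / 2`,
contradicting `χ_0 ≤ M_L ≤ 2B`. Everything is proved for an abstract family of nonnegative box couplings
(`iSup_tsum_eq_top_of_threshold`) and specialised in the last line. Sources: M. Aizenman, C. M. Newman,
J. Stat. Phys. 36 (1984) (openness of `{χ < ∞}`); J. Glimm, A. Jaffe, *Quantum Physics* (1987) §4.2, Cor. 4.3.3;
H. Duminil-Copin, ICM 2022 §7.1; S. Friedli, Y. Velenik (2017) Thm. 3.49. No definitions, no named facts.
-/

noncomputable section

namespace Summit.CriticalPhenomena.Ising3DConformalLimit.Cruxes.TwinTransparency.ReplicaMirror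

open scoped BigOperators Topology Manifold Classical MeasureTheory ProbabilityTheory Matrix InnerProductSpace ComplexConjugate ContinuousMap
open Filter Set Function TopologicalSpace MeasureTheory
open Literature.Probability.LatticeModels
open Summit.CriticalPhenomena.Ising3DConformalLimit.Cruxes.ExistsScaleCovariantLimit.DecimationHomotopyRate
open Literature.Barriers.CriticalPhenomena.SpreadOutIsing (inv_sub_inv_le_of_increment)

/-! ## §1 Elementary facts: the seam coupling is nonnegative, pair monomials, GKS I for a pair -/

-- adapted from `ReflectionTwinTwinTransparencyTwinBoxMonotone.seamCoupling_nonneg` (private there)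
/-- The twin coupling `β_c/2 · (J on seam bonds, 1 on bulk bonds)` (and `0` on non-bonds) is nonnegative for
`J ≥ 0` (`β_c(3) ≥ 0`). [folklore] -/
private theorem seamCoupling_nonneg {P Q : Prop} [Decidable P] [Decidable Q] {J : ℝ} (hJ : 0 ≤ J) :
    0 ≤ (if P then (criticalBeta 3 / 2) * (if Q then J else 1) else 0 : ℝ) := by
  have hβ : 0 ≤ criticalBeta 3 / 2 := div_nonneg (criticalBeta_nonneg 3) zero_le_two
  split_ifs
  · exact mul_nonneg hβ hJ
  · exact mul_nonneg hβ zero_le_one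
  · exact le_rfl

/-- The box monomial (junk factor `0` off the box) of the pair `![a, b]` of box sites is `σ_a σ_b`. [folklore] -/
private theorem boxMonomial_pair {L : ℕ} (a b : ↥(box 3 L)) :
    (fun s : SpinConfig ↥(box 3 L) => ∏ i, if h : ![a.1, b.1] i ∈ box 3 L then
      spinAt (⟨![a.1, b.1] i, h⟩ : ↥(box 3 L)) s else (0 : ℝ)) = fun s => spinAt a s * spinAt b s := by
  funext s
  simp only [Fin.prod_univ_two, Matrix.cons_val_zero, Matrix.cons_val_one, dif_pos a.2, dif_pos b.2]

/-- **GKS I for a pair**: `⟨σ_aσ_b⟩_c ≥ 0` for a nonnegative coupling matrix (`σ_aσ_a = 1`; otherwise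
`σ_aσ_b = σ_{{a,b}}`). [cite: FriedliVelenik2017, Thm. 3.49, eq. (3.54)] -/
private theorem gibbsAvg_pair_nonneg {V : Type*} [Fintype V] [DecidableEq V] {c : V → V → ℝ}
    (hc : ∀ a b, 0 ≤ c a b) (a b : V) : 0 ≤ PairIsing.gibbsAvg c (fun s => spinAt a s * spinAt b s) := by
  by_cases hab : a = b
  · subst hab
    simp only [spinAt_mul_self, PairIsing.gibbsAvg_const]
    exact zero_le_one
  · have h : (fun s : SpinConfig V => spinAt a s * spinAt b s) = spinProduct {a, b} :=
      funext fun s => by rw [spinProduct, Finset.prod_pair hab]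
    rw [h]
    exact TwoCouplingGKS.gibbsAvg_spinProduct_nonneg hc _

/-! ## §2 Finite slab row sums are below the slab susceptibility -/

/-- If `sup_x Σ'_y t(x,y) < ∞` over the slab `T = {-1 ≤ h ≤ 1}` (in `[0,∞]`, via `ENNReal.ofReal`), then for a slab
site `a` of a box and `t(a, ·) ≥ 0` on the box, the finite slab row sum `Σ_{b ∈ T ∩ Λ_L} t(a,b)` is below its real
value (finite sum ≤ `tsum` ≤ `iSup`). [folklore] -/
private theorem sum_slab_le_toReal (t : Site 3 → Site 3 → ℝ) {L : ℕ} {a : ↥(box 3 L)}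
    (ht : ∀ b : ↥(box 3 L), 0 ≤ t a.1 b.1)
    (hfin : (⨆ x : {y : Site 3 // (-1 ≤ y 0 + y 1 + y 2 ∧ y 0 + y 1 + y 2 ≤ 1)},
      ∑' y : {y : Site 3 // (-1 ≤ y 0 + y 1 + y 2 ∧ y 0 + y 1 + y 2 ≤ 1)}, ENNReal.ofReal (t x.1 y.1)) ≠ ⊤)
    (ha : (-1 ≤ a.1 0 + a.1 1 + a.1 2 ∧ a.1 0 + a.1 1 + a.1 2 ≤ 1)) :
    (∑ b : ↥(box 3 L), if (-1 ≤ b.1 0 + b.1 1 + b.1 2 ∧ b.1 0 + b.1 1 + b.1 2 ≤ 1) then t a.1 b.1 else 0) ≤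
      (⨆ x : {y : Site 3 // (-1 ≤ y 0 + y 1 + y 2 ∧ y 0 + y 1 + y 2 ≤ 1)},
        ∑' y : {y : Site 3 // (-1 ≤ y 0 + y 1 + y 2 ∧ y 0 + y 1 + y 2 ≤ 1)},
          ENNReal.ofReal (t x.1 y.1)).toReal := by
  rw [← ENNReal.ofReal_le_iff_le_toReal hfin,
    ENNReal.ofReal_sum_of_nonneg fun b _ => by split_ifs; exacts [ht b, le_rfl]]
  calc ∑ b : ↥(box 3 L), ENNReal.ofReal
        (if (-1 ≤ b.1 0 + b.1 1 + b.1 2 ∧ b.1 0 + b.1 1 + b.1 2 ≤ 1) then t a.1 b.1 else 0)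
      = ∑ y ∈ box 3 L, ENNReal.ofReal (if (-1 ≤ y 0 + y 1 + y 2 ∧ y 0 + y 1 + y 2 ≤ 1) then t a.1 y else 0) :=
        Finset.sum_coe_sort (box 3 L)
          (fun y => ENNReal.ofReal (if (-1 ≤ y 0 + y 1 + y 2 ∧ y 0 + y 1 + y 2 ≤ 1) then t a.1 y else 0))
    _ = ∑ y ∈ (box 3 L).filter (fun y => (-1 ≤ y 0 + y 1 + y 2 ∧ y 0 + y 1 + y 2 ≤ 1)),
          ENNReal.ofReal (t a.1 y) := by
        rw [Finset.sum_filter]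
        exact Finset.sum_congr rfl fun y _ => by split_ifs; exacts [rfl, ENNReal.ofReal_zero]
    _ = ∑ y ∈ (box 3 L).subtype (fun y => (-1 ≤ y 0 + y 1 + y 2 ∧ y 0 + y 1 + y 2 ≤ 1)),
          ENNReal.ofReal (t a.1 y.1) :=
        (Finset.sum_subtype_eq_sum_filter _).symm
    _ ≤ ∑' y : {y : Site 3 // (-1 ≤ y 0 + y 1 + y 2 ∧ y 0 + y 1 + y 2 ≤ 1)}, ENNReal.ofReal (t a.1 y.1) :=
        ENNReal.sum_le_tsum _
    _ ≤ ⨆ x : {y : Site 3 // (-1 ≤ y 0 + y 1 + y 2 ∧ y 0 + y 1 + y 2 ≤ 1)},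
          ∑' y : {y : Site 3 // (-1 ≤ y 0 + y 1 + y 2 ∧ y 0 + y 1 + y 2 ≤ 1)}, ENNReal.ofReal (t x.1 y.1) :=
        le_iSup (fun x : {y : Site 3 // (-1 ≤ y 0 + y 1 + y 2 ∧ y 0 + y 1 + y 2 ≤ 1)} =>
          ∑' y : {y : Site 3 // (-1 ≤ y 0 + y 1 + y 2 ∧ y 0 + y 1 + y 2 ≤ 1)}, ENNReal.ofReal (t x.1 y.1))
          ⟨a.1, ha⟩

/-! ## §3 The argument for an abstract family of nonnegative box couplings -/

/-- **Openness of finite slab susceptibility / a continuous threshold is plane-critical, abstract form.** For box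
couplings `cpl J L ≥ 0` (`J ≥ 0`) whose box monomial averages are non-decreasing in the box and in `J` and bounded
by `1`, and whose slab sums obey the Lebowitz increment bound `χ_a(J₂) - χ_a(J₁) ≤ 12 β_c (J₂ - J₁) M²`: if `J > 0`
and there is plane long-range order at every `J' > J`, then the slab susceptibility at `J` is infinite. (Partition
lemma `inv_sub_inv_le_of_increment` for the box maxima `M_L ≥ 1`; a finite `slabChi J` would bound `M_L(J + ε)`
uniformly in `L`, contradicting `N` plane sites with correlations `≥ m/2` in one large box.)
[cite: GlimmJaffe1987, §4.2 and Cor. 4.3.3] [cite: DuminilCopinICM2022, §7.1] -/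
private theorem iSup_tsum_eq_top_of_threshold {cpl : ℝ → (L : ℕ) → ↥(box 3 L) → ↥(box 3 L) → ℝ}
    (hvol : ∀ (J : ℝ) (k : ℕ) (z : Fin k → Site 3) (L L' : ℕ), 0 ≤ J → L ≤ L' →
      PairIsing.gibbsAvg (cpl J L)
          (fun s => ∏ i, if h : z i ∈ box 3 L then spinAt (⟨z i, h⟩ : ↥(box 3 L)) s else 0) ≤
        PairIsing.gibbsAvg (cpl J L')
          (fun s => ∏ i, if h : z i ∈ box 3 L' then spinAt (⟨z i, h⟩ : ↥(box 3 L')) s else 0))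
    (hJm : ∀ (J J' : ℝ) (k : ℕ) (z : Fin k → Site 3) (L : ℕ), 0 ≤ J → J ≤ J' →
      PairIsing.gibbsAvg (cpl J L)
          (fun s => ∏ i, if h : z i ∈ box 3 L then spinAt (⟨z i, h⟩ : ↥(box 3 L)) s else 0) ≤
        PairIsing.gibbsAvg (cpl J' L)
          (fun s => ∏ i, if h : z i ∈ box 3 L then spinAt (⟨z i, h⟩ : ↥(box 3 L)) s else 0))
    (habs : ∀ (J : ℝ) (k : ℕ) (z : Fin k → Site 3) (L : ℕ), |PairIsing.gibbsAvg (cpl J L)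
      (fun s => ∏ i, if h : z i ∈ box 3 L then spinAt (⟨z i, h⟩ : ↥(box 3 L)) s else 0)| ≤ 1)
    (hinc : ∀ (L : ℕ) (J₁ J₂ M : ℝ), 0 ≤ J₁ → J₁ ≤ J₂ →
      (∀ a : ↥(box 3 L), (-1 ≤ a.1 0 + a.1 1 + a.1 2 ∧ a.1 0 + a.1 1 + a.1 2 ≤ 1) →
        (∑ b : ↥(box 3 L), if (-1 ≤ b.1 0 + b.1 1 + b.1 2 ∧ b.1 0 + b.1 1 + b.1 2 ≤ 1) then
          PairIsing.gibbsAvg (cpl J₂ L) (fun s => spinAt a s * spinAt b s) else 0) ≤ M) →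
      ∀ a : ↥(box 3 L), (-1 ≤ a.1 0 + a.1 1 + a.1 2 ∧ a.1 0 + a.1 1 + a.1 2 ≤ 1) →
        (∑ b : ↥(box 3 L), if (-1 ≤ b.1 0 + b.1 1 + b.1 2 ∧ b.1 0 + b.1 1 + b.1 2 ≤ 1) then
            PairIsing.gibbsAvg (cpl J₂ L) (fun s => spinAt a s * spinAt b s) else 0) -
          (∑ b : ↥(box 3 L), if (-1 ≤ b.1 0 + b.1 1 + b.1 2 ∧ b.1 0 + b.1 1 + b.1 2 ≤ 1) then
            PairIsing.gibbsAvg (cpl J₁ L) (fun s => spinAt a s * spinAt b s) else 0) ≤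
          12 * criticalBeta 3 * (J₂ - J₁) * M ^ 2)
    (hcpl : ∀ J : ℝ, 0 ≤ J → ∀ (L : ℕ) (a b : ↥(box 3 L)), 0 ≤ cpl J L a b)
    {J : ℝ} (hJ : 0 < J)
    (hLRO : ∀ J' : ℝ, J < J' → ∃ m : ℝ, 0 < m ∧ ∀ c : Site 3, c 0 + c 1 + c 2 = 0 →
      m ≤ ⨆ L : ℕ, PairIsing.gibbsAvg (cpl J' L)
        (fun s => ∏ i, if h : ![0, c] i ∈ box 3 L then spinAt (⟨![0, c] i, h⟩ : ↥(box 3 L)) s else 0)) :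
    (⨆ x : {y : Site 3 // (-1 ≤ y 0 + y 1 + y 2 ∧ y 0 + y 1 + y 2 ≤ 1)},
      ∑' y : {y : Site 3 // (-1 ≤ y 0 + y 1 + y 2 ∧ y 0 + y 1 + y 2 ≤ 1)},
        ENNReal.ofReal (⨆ L : ℕ, PairIsing.gibbsAvg (cpl J L) (fun s => ∏ i,
          if h : ![x.1, y.1] i ∈ box 3 L then spinAt (⟨![x.1, y.1] i, h⟩ : ↥(box 3 L)) s else 0))) = ⊤ := by
  have hJ0 : 0 ≤ J := hJ.le
  /- opaque names: pair correlations `E`, their sup over boxes `T`, the slab `TL L ⊆ Λ_L`, slab sums `S` -/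
  obtain ⟨E, hE⟩ : ∃ E : ℝ → (L : ℕ) → ↥(box 3 L) → ↥(box 3 L) → ℝ,
      ∀ J L a b, E J L a b = PairIsing.gibbsAvg (cpl J L) (fun s => spinAt a s * spinAt b s) :=
    ⟨_, fun _ _ _ _ => rfl⟩
  obtain ⟨T, hT⟩ : ∃ T : ℝ → Site 3 → Site 3 → ℝ, ∀ J x y, T J x y = ⨆ L : ℕ, PairIsing.gibbsAvg (cpl J L)
      (fun s => ∏ i, if h : ![x, y] i ∈ box 3 L then spinAt (⟨![x, y] i, h⟩ : ↥(box 3 L)) s else 0) :=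
    ⟨_, fun _ _ _ => rfl⟩
  obtain ⟨TL, hTLdef⟩ : ∃ TL : (L : ℕ) → Finset ↥(box 3 L), ∀ L, TL L =
      Finset.univ.filter fun a : ↥(box 3 L) => (-1 ≤ a.1 0 + a.1 1 + a.1 2 ∧ a.1 0 + a.1 1 + a.1 2 ≤ 1) :=
    ⟨_, fun _ => rfl⟩
  have hTL : ∀ L (a : ↥(box 3 L)), a ∈ TL L ↔ (-1 ≤ a.1 0 + a.1 1 + a.1 2 ∧ a.1 0 + a.1 1 + a.1 2 ≤ 1) :=
    fun L a => by rw [hTLdef, Finset.mem_filter]; exact and_iff_right (Finset.mem_univ a)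
  have hsumTL : ∀ L (f : ↥(box 3 L) → ℝ),
      (∑ b, if (-1 ≤ b.1 0 + b.1 1 + b.1 2 ∧ b.1 0 + b.1 1 + b.1 2 ≤ 1) then f b else 0) = ∑ b ∈ TL L, f b :=
    fun L f => by rw [hTLdef, Finset.sum_filter]
  obtain ⟨S, hS⟩ : ∃ S : ℝ → (L : ℕ) → ↥(box 3 L) → ℝ, ∀ J L a, S J L a = ∑ b ∈ TL L, E J L a b :=
    ⟨_, fun _ _ _ => rfl⟩
  simp only [← hT]
  by_contra hfin
  /- (0) basic facts on the pair correlations -/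
  have hE0 : ∀ J L a b, 0 ≤ J → 0 ≤ E J L a b := fun J L a b hJ => by
    rw [hE]; exact gibbsAvg_pair_nonneg (hcpl J hJ L) a b
  have hEbox : ∀ J L (a b : ↥(box 3 L)), E J L a b = PairIsing.gibbsAvg (cpl J L) (fun s => ∏ i,
      if h : ![a.1, b.1] i ∈ box 3 L then spinAt (⟨![a.1, b.1] i, h⟩ : ↥(box 3 L)) s else 0) :=
    fun J L a b => by rw [hE, boxMonomial_pair]
  have hEmono : ∀ J J' L a b, 0 ≤ J → J ≤ J' → E J L a b ≤ E J' L a b := fun J J' L a b hJ hJJ' => by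
    rw [hEbox, hEbox]; exact hJm J J' 2 _ L hJ hJJ'
  have hET : ∀ J L (a b : ↥(box 3 L)), E J L a b ≤ T J a.1 b.1 := fun J L a b => by
    rw [hEbox, hT]
    have hbdd : BddAbove (Set.range fun L' : ℕ => PairIsing.gibbsAvg (cpl J L') (fun s => ∏ i,
        if h : ![a.1, b.1] i ∈ box 3 L' then spinAt (⟨![a.1, b.1] i, h⟩ : ↥(box 3 L')) s else 0)) :=
      ⟨1, by rintro _ ⟨L', rfl⟩; exact (le_abs_self _).trans (habs J 2 _ L')⟩
    exact le_ciSup hbdd L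
  have hEdiag : ∀ J L a, E J L a a = 1 := fun J L a => by
    rw [hE]; simp only [spinAt_mul_self]; exact PairIsing.gibbsAvg_const _ 1
  /- (1) every box slab sum at `J` is below `(slabChi J).toReal ≤ B`, `1 ≤ B` -/
  obtain ⟨B, hB1, hSB⟩ : ∃ B : ℝ, 1 ≤ B ∧ ∀ L, ∀ a ∈ TL L, S J L a ≤ B := by
    refine ⟨max (⨆ x : {y : Site 3 // (-1 ≤ y 0 + y 1 + y 2 ∧ y 0 + y 1 + y 2 ≤ 1)},
      ∑' y : {y : Site 3 // (-1 ≤ y 0 + y 1 + y 2 ∧ y 0 + y 1 + y 2 ≤ 1)}, ENNReal.ofReal (T J x.1 y.1)).toReal 1,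
      le_max_right _ _, fun L a ha => (le_max_left _ _).trans' ?_⟩
    rw [hS]
    refine (Finset.sum_le_sum fun b _ => hET J L a b).trans ?_
    rw [← hsumTL]
    exact sum_slab_le_toReal (T J) (fun b => (hE0 J L a b hJ0).trans (hET J L a b)) hfin ((hTL L a).1 ha)
  have hB0 : 0 < B := one_pos.trans_le hB1
  /- (2) the box maxima `M L t = max_{a ∈ T ∩ Λ_L} S t L a`: `≥ 1`, non-decreasing, Lebowitz increment -/
  have h0TL : ∀ L, (⟨0, zero_mem_box 3 L⟩ : ↥(box 3 L)) ∈ TL L := fun L => (hTL L _).2 (by simp)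
  have hne : ∀ L, (TL L).Nonempty := fun L => ⟨_, h0TL L⟩
  obtain ⟨M, hSM, hMS⟩ : ∃ M : ℕ → ℝ → ℝ, (∀ L t, ∀ a ∈ TL L, S t L a ≤ M L t) ∧
      (∀ L t, ∃ a ∈ TL L, M L t = S t L a) :=
    ⟨fun L t => (TL L).sup' (hne L) (fun a => S t L a), fun L t a ha => Finset.le_sup' (fun a => S t L a) ha,
      fun L t => Finset.exists_mem_eq_sup' (hne L) (fun a => S t L a)⟩
  have hS1 : ∀ L t, 0 ≤ t → ∀ a ∈ TL L, 1 ≤ S t L a := fun L t ht a ha => by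
    rw [hS, ← hEdiag t L a]
    exact Finset.single_le_sum (f := fun b => E t L a b) (fun b _ => hE0 t L a b ht) ha
  have hM1 : ∀ L t, 0 ≤ t → 1 ≤ M L t := fun L t ht => (hS1 L t ht _ (h0TL L)).trans (hSM L t _ (h0TL L))
  have hSmono : ∀ L s t (a : ↥(box 3 L)), 0 ≤ s → s ≤ t → S s L a ≤ S t L a := fun L s t a hs hst => by
    rw [hS, hS]; exact Finset.sum_le_sum fun b _ => hEmono s t L a b hs hst
  have hMmono : ∀ L s t, 0 ≤ s → s ≤ t → M L s ≤ M L t := fun L s t hs hst => by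
    obtain ⟨a, ha, h⟩ := hMS L s
    rw [h]; exact (hSmono L s t a hs hst).trans (hSM L t a ha)
  have hincS : ∀ (L : ℕ) (J₁ J₂ Mb : ℝ), 0 ≤ J₁ → J₁ ≤ J₂ → (∀ a ∈ TL L, S J₂ L a ≤ Mb) →
      ∀ a ∈ TL L, S J₂ L a - S J₁ L a ≤ 12 * criticalBeta 3 * (J₂ - J₁) * Mb ^ 2 := by
    intro L J₁ J₂ Mb h1 h12 hMb a ha
    have hS' : ∀ J' (x : ↥(box 3 L)), S J' L x = ∑ b : ↥(box 3 L),
        if (-1 ≤ b.1 0 + b.1 1 + b.1 2 ∧ b.1 0 + b.1 1 + b.1 2 ≤ 1) then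
          PairIsing.gibbsAvg (cpl J' L) (fun s => spinAt x s * spinAt b s) else 0 := by
      intro J' x; rw [hS, ← hsumTL]; simp only [hE]
    rw [hS', hS']
    exact hinc L J₁ J₂ Mb h1 h12 (fun b hb => (hS' J₂ b) ▸ hMb b ((hTL L b).2 hb)) a ((hTL L a).1 ha)
  have hMinc : ∀ L s t, 0 ≤ s → s ≤ t → M L t - M L s ≤ 12 * criticalBeta 3 * (t - s) * M L t ^ 2 := by
    intro L s t hs hst
    obtain ⟨a, ha, h⟩ := hMS L t
    have h2 : S s L a ≤ M L s := hSM L s a ha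
    have h3 := hincS L s t (M L t) hs hst (fun b hb => hSM L t b hb) a ha
    rw [← h] at h3
    linarith
  /- (3) the partition lemma: a uniform bound `M L (J + ε) ≤ 2B` -/
  obtain ⟨ε, hε0, hDε⟩ : ∃ ε : ℝ, 0 < ε ∧ 12 * criticalBeta 3 * ε ≤ B⁻¹ / 2 := by
    have hD0 : 0 ≤ 12 * criticalBeta 3 := mul_nonneg (by norm_num) (criticalBeta_nonneg 3)
    have hy : 0 < B⁻¹ / 2 := by positivity
    refine ⟨B⁻¹ / 2 / (12 * criticalBeta 3 + 1), by positivity, ?_⟩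
    rw [mul_div_assoc', div_le_iff₀ (by positivity)]
    calc 12 * criticalBeta 3 * (B⁻¹ / 2) ≤ 12 * criticalBeta 3 * (B⁻¹ / 2) + B⁻¹ / 2 :=
        le_add_of_nonneg_right hy.le
      _ = B⁻¹ / 2 * (12 * criticalBeta 3 + 1) := by ring
  have hMB : ∀ L, M L (J + ε) ≤ 2 * B := by
    intro L
    have hkey : (M L J)⁻¹ - (M L (J + ε))⁻¹ ≤ 12 * criticalBeta 3 * (J + ε - J) :=
      inv_sub_inv_le_of_increment (f := M L) (by linarith) (mul_nonneg (by norm_num) (criticalBeta_nonneg 3))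
        (fun t ht => hM1 L t (hJ0.trans ht.1))
        (by intro s hs t _ hst; exact hMmono L s t (hJ0.trans hs.1) hst)
        (by intro s hs t _ hst; exact hMinc L s t (hJ0.trans hs.1) hst)
    rw [add_sub_cancel_left] at hkey
    have hMJ : M L J ≤ B := by obtain ⟨a, ha, h⟩ := hMS L J; rw [h]; exact hSB L a ha
    have h1 : B⁻¹ ≤ (M L J)⁻¹ := inv_anti₀ (one_pos.trans_le (hM1 L J hJ0)) hMJ
    have hpos : 0 < M L (J + ε) := one_pos.trans_le (hM1 L (J + ε) (by linarith))
    have h2 : B⁻¹ / 2 ≤ (M L (J + ε))⁻¹ := by linarith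
    rw [← inv_le_inv₀ (by positivity) hpos]
    calc (2 * B)⁻¹ = B⁻¹ / 2 := by ring
      _ ≤ _ := h2
  /- (4) plane long-range order at `J + ε` contradicts the uniform bound -/
  obtain ⟨m, hm, hplane⟩ := hLRO (J + ε) (by linarith)
  obtain ⟨N, hN⟩ := exists_nat_gt (2 * B / (m / 2))
  have hNm : 2 * B < N * (m / 2) := (div_lt_iff₀ (by positivity)).1 hN
  -- for each plane site `(n, -n, 0)` a box whose correlation with the origin exceeds `m / 2`
  have hbox : ∀ n : ℕ, ∃ Ln : ℕ, m / 2 < PairIsing.gibbsAvg (cpl (J + ε) Ln) (fun s => ∏ i,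
      if h : ![0, ![(n : ℤ), -(n : ℤ), 0]] i ∈ box 3 Ln then
        spinAt (⟨![0, ![(n : ℤ), -(n : ℤ), 0]] i, h⟩ : ↥(box 3 Ln)) s else 0) := fun n =>
    exists_lt_of_lt_ciSup ((half_lt_self hm).trans_le (hplane ![(n : ℤ), -(n : ℤ), 0] (by simp)))
  choose Ln hLn using hbox
  obtain ⟨L, hNL, hLnL⟩ : ∃ L : ℕ, N ≤ L ∧ ∀ n, n < N → Ln n ≤ L :=
    ⟨N + ∑ n ∈ Finset.range N, Ln n, Nat.le_add_right _ _, fun n hn =>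
      (Finset.single_le_sum (fun _ _ => Nat.zero_le _) (Finset.mem_range.2 hn)).trans (Nat.le_add_left _ _)⟩
  have hpbox : ∀ n, n < N → (![(n : ℤ), -(n : ℤ), 0] : Site 3) ∈ box 3 L := by
    intro n hn
    have hnL : n ≤ L := hn.le.trans hNL
    rw [mem_box]
    intro i
    fin_cases i <;> simp <;> omega
  obtain ⟨o, ho⟩ : ∃ o : ↥(box 3 L), o.1 = 0 := ⟨⟨0, zero_mem_box 3 L⟩, rfl⟩
  have hoTL : o ∈ TL L := (hTL L o).2 (by rw [ho]; simp)
  -- the `N` plane sites inside the box, as box sites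
  obtain ⟨P, hPcard, hPmem⟩ : ∃ P : Finset ↥(box 3 L), P.card = N ∧
      ∀ b ∈ P, ∃ n, n < N ∧ (![(n : ℤ), -(n : ℤ), 0] : Site 3) = b.1 := by
    refine ⟨((Finset.range N).image fun n : ℕ => (![(n : ℤ), -(n : ℤ), 0] : Site 3)).subtype (· ∈ box 3 L),
      ?_, fun b hb => ?_⟩
    · rw [Finset.card_subtype, Finset.filter_true_of_mem, Finset.card_image_of_injective, Finset.card_range]
      · intro n n' h
        simpa using congrFun h 0
      · intro y hy
        obtain ⟨n, hn, rfl⟩ := Finset.mem_image.1 hy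
        exact hpbox n (Finset.mem_range.1 hn)
    · obtain ⟨n, hn, h⟩ := Finset.mem_image.1 (Finset.mem_subtype.1 hb)
      exact ⟨n, Finset.mem_range.1 hn, h⟩
  have hPTL : P ⊆ TL L := fun b hb => by
    obtain ⟨n, _, hbn⟩ := hPmem b hb
    exact (hTL L b).2 (by rw [← hbn]; simp)
  have hPb : ∀ b ∈ P, m / 2 ≤ E (J + ε) L o b := by
    intro b hb
    obtain ⟨n, hn, hbn⟩ := hPmem b hb
    rw [hEbox]
    have hz : (![o.1, b.1] : Fin 2 → Site 3) = ![0, ![(n : ℤ), -(n : ℤ), 0]] := by rw [ho, ← hbn]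
    rw [hz]
    exact (hLn n).le.trans (hvol (J + ε) 2 _ (Ln n) L (by linarith) (hLnL n hn))
  have hsum : (N : ℝ) * (m / 2) ≤ S (J + ε) L o := by
    rw [hS]
    calc (N : ℝ) * (m / 2) = P.card • (m / 2) := by rw [hPcard, nsmul_eq_mul]
      _ ≤ ∑ b ∈ P, E (J + ε) L o b := Finset.card_nsmul_le_sum P _ _ hPb
      _ ≤ ∑ b ∈ TL L, E (J + ε) L o b :=
          Finset.sum_le_sum_of_subset_of_nonneg hPTL fun b _ _ => hE0 _ L o b (by linarith)
  have h1 := hSM L (J + ε) o hoTL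
  have h2 := hMB L
  linarith

/-! ## §4 The registered stub -/

/-- **stub_thresholdNotCut (S3 — A CONTINUOUS THRESHOLD IS PLANE-CRITICAL: `χ_T(J*) = ∞`; provable now from
S1 + S2, size M; theorem `ThresholdNotCut` of idea `threshold-lebowitz-calculus`).** From S2 and the partition lemma
`inv_sub_inv_le_of_increment` (`Literature/Barriers/CriticalPhenomena/LaceExpansionIsingAboveFourProofs.lean`) applied
to the non-decreasing (S1) box maximum `M_L(J) = max_{a ∈ T_L} χ_a(J) ≥ 1`: `M_L(J₁)⁻¹ - M_L(J₂)⁻¹ ≤ 12β_c(J₂ - J₁)`, so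
finiteness of the slab susceptibility `slabChi` (sup over boxes = monotone limit, S1; `ENNReal.tsum_eq_iSup_sum`) is an
OPEN condition in `J ≥ 0` (a bound at `J₁` gives the uniform-in-`L` bound `(χ⁻¹ - 12β_cε)⁻¹` at `J₁ + ε`); but plane
long-range order at every `J' > J*` makes `slabChi J' = ⊤` (the origin is a slab site; infinitely many plane sites
`(n,-n,0)` with `⟨σ₀σ_c⟩ ≥ m > 0`), hence `slabChi J* = ⊤`. Only the clause `∀ J' > J*, LRO J'` of the threshold is
used. [cite: AizenmanNewman1984, openness of finite susceptibility] [cite: DuminilCopinICM2022, §7.1] -/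
theorem stub_thresholdNotCut :
    (fun (IsSeamThreshold : ℝ → Prop) (slabChi : ℝ → ENNReal) => ((fun (twinBox : ℝ → ℕ → (k : ℕ) → (Fin k → Site 3) → ℝ) => (∀ (J : ℝ) (k : ℕ) (z : Fin k → Site 3) (L L' : ℕ), 0 ≤ J → L ≤ L' → twinBox J L k z ≤ twinBox J L' k z) ∧ (∀ (J J' : ℝ) (k : ℕ) (z : Fin k → Site 3) (L : ℕ), 0 ≤ J → J ≤ J' → twinBox J L k z ≤ twinBox J' L k z) ∧ (∀ (J : ℝ) (k : ℕ) (z : Fin k → Site 3) (L : ℕ), |twinBox J L k z| ≤ 1)) (fun (J : ℝ) (L : ℕ) (k : ℕ) (z : Fin k → Site 3) => PairIsing.gibbsAvg (fun a b : ↥(box 3 L) => if (((∑ i, |a.1 i - b.1 i| = 1) ∧ ¬ ((a.1 0 + a.1 1 + a.1 2 = 0 ∧ b.1 0 + b.1 1 + b.1 2 = 1) ∨ (a.1 0 + a.1 1 + a.1 2 = 1 ∧ b.1 0 + b.1 1 + b.1 2 = 0))) ∨ (((a.1 0 + a.1 1 + a.1 2 = 0 ∧ b.1 0 + b.1 1 +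 b.1 2 = 1) ∨ (a.1 0 + a.1 1 + a.1 2 = 1 ∧ b.1 0 + b.1 1 + b.1 2 = 0)) ∧ ∃ i : Fin 3, a.1 + b.1 = Pi.single i 1)) then (criticalBeta 3 / 2) * (if a.1 0 + a.1 1 + a.1 2 = 0 ∨ b.1 0 + b.1 1 + b.1 2 = 0 then J else 1) else 0) (fun s => ∏ i, if h : z i ∈ box 3 L then spinAt (⟨z i, h⟩ : ↥(box 3 L)) s else 0))) → ((fun (slabSum : ℝ → (L : ℕ) → ↥(box 3 L) → ℝ) => ∀ (L : ℕ) (J₁ J₂ M : ℝ), 0 ≤ J₁ → J₁ ≤ J₂ → (∀ a : ↥(box 3 L), (-1 ≤ a.1 0 + a.1 1 + a.1 2 ∧ a.1 0 + a.1 1 + a.1 2 ≤ 1) → slabSum J₂ L a ≤ M) → ∀ a : ↥(box 3 L), (-1 ≤ a.1 0 + a.1 1 + a.1 2 ∧ a.1 0 + a.1 1 + a.1 2 ≤ 1) → slabSum J₂ L a - slabSum J₁ L a ≤ 12 * criticalBeta 3 * (J₂ - J₁) * M ^ 2) (fun (J : ℝ) (L : ℕ) (a : ↥(box 3 L)) =>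 ∑ b : ↥(box 3 L), if (-1 ≤ b.1 0 + b.1 1 + b.1 2 ∧ b.1 0 + b.1 1 + b.1 2 ≤ 1) then PairIsing.gibbsAvg (fun a b : ↥(box 3 L) => if (((∑ i, |a.1 i - b.1 i| = 1) ∧ ¬ ((a.1 0 + a.1 1 + a.1 2 = 0 ∧ b.1 0 + b.1 1 + b.1 2 = 1) ∨ (a.1 0 + a.1 1 + a.1 2 = 1 ∧ b.1 0 + b.1 1 + b.1 2 = 0))) ∨ (((a.1 0 + a.1 1 + a.1 2 = 0 ∧ b.1 0 + b.1 1 + b.1 2 = 1) ∨ (a.1 0 + a.1 1 + a.1 2 = 1 ∧ b.1 0 + b.1 1 + b.1 2 = 0)) ∧ ∃ i : Fin 3, a.1 + b.1 = Pi.single i 1)) then (criticalBeta 3 / 2) * (if a.1 0 + a.1 1 + a.1 2 = 0 ∨ b.1 0 + b.1 1 + b.1 2 = 0 then J else 1) else 0) (fun s => spinAt a s * spinAt b s) else 0)) → ∀ J : ℝ, IsSeamThreshold J → slabChi J = ⊤) (fun J : ℝ => 0 < J ∧ ¬ (fun J : ℝ => ∃ m : ℝ, 0 < m ∧ ∀ c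 : Site 3, c 0 + c 1 + c 2 = 0 → m ≤ (fun (J : ℝ) (k : ℕ) (z : Fin k → Site 3) => ⨆ L : ℕ, PairIsing.gibbsAvg (fun a b : ↥(box 3 L) => if (((∑ i, |a.1 i - b.1 i| = 1) ∧ ¬ ((a.1 0 + a.1 1 + a.1 2 = 0 ∧ b.1 0 + b.1 1 + b.1 2 = 1) ∨ (a.1 0 + a.1 1 + a.1 2 = 1 ∧ b.1 0 + b.1 1 + b.1 2 = 0))) ∨ (((a.1 0 + a.1 1 + a.1 2 = 0 ∧ b.1 0 + b.1 1 + b.1 2 = 1) ∨ (a.1 0 + a.1 1 + a.1 2 = 1 ∧ b.1 0 + b.1 1 + b.1 2 = 0)) ∧ ∃ i : Fin 3, a.1 + b.1 = Pi.single i 1)) then (criticalBeta 3 / 2) * (if a.1 0 + a.1 1 + a.1 2 = 0 ∨ b.1 0 + b.1 1 + b.1 2 = 0 then J else 1) else 0) (fun s => ∏ i, if h : z i ∈ box 3 L then spinAt (⟨z i, h⟩ : ↥(box 3 L)) s else 0)) J 2 ![0, c]) J ∧ ∀ J' : ℝ, J < J' → (fun J : ℝ => ∃ m : ℝ, 0 <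 m ∧ ∀ c : Site 3, c 0 + c 1 + c 2 = 0 → m ≤ (fun (J : ℝ) (k : ℕ) (z : Fin k → Site 3) => ⨆ L : ℕ, PairIsing.gibbsAvg (fun a b : ↥(box 3 L) => if (((∑ i, |a.1 i - b.1 i| = 1) ∧ ¬ ((a.1 0 + a.1 1 + a.1 2 = 0 ∧ b.1 0 + b.1 1 + b.1 2 = 1) ∨ (a.1 0 + a.1 1 + a.1 2 = 1 ∧ b.1 0 + b.1 1 + b.1 2 = 0))) ∨ (((a.1 0 + a.1 1 + a.1 2 = 0 ∧ b.1 0 + b.1 1 + b.1 2 = 1) ∨ (a.1 0 + a.1 1 + a.1 2 = 1 ∧ b.1 0 + b.1 1 + b.1 2 = 0)) ∧ ∃ i : Fin 3, a.1 + b.1 = Pi.single i 1)) then (criticalBeta 3 / 2) * (if a.1 0 + a.1 1 + a.1 2 = 0 ∨ b.1 0 + b.1 1 + b.1 2 = 0 then J else 1) else 0) (fun s => ∏ i, if h : z i ∈ box 3 L then spinAt (⟨z i, h⟩ : ↥(box 3 L)) s else 0)) J 2 ![0, c]) J') (fun J : ℝ => ⨆ x : {y : Site 3 // (-1 ≤ y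 0 + y 1 + y 2 ∧ y 0 + y 1 + y 2 ≤ 1)}, ∑' y : {y : Site 3 // (-1 ≤ y 0 + y 1 + y 2 ∧ y 0 + y 1 + y 2 ≤ 1)}, ENNReal.ofReal ((fun (J : ℝ) (k : ℕ) (z : Fin k → Site 3) => ⨆ L : ℕ, PairIsing.gibbsAvg (fun a b : ↥(box 3 L) => if (((∑ i, |a.1 i - b.1 i| = 1) ∧ ¬ ((a.1 0 + a.1 1 + a.1 2 = 0 ∧ b.1 0 + b.1 1 + b.1 2 = 1) ∨ (a.1 0 + a.1 1 + a.1 2 = 1 ∧ b.1 0 + b.1 1 + b.1 2 = 0))) ∨ (((a.1 0 + a.1 1 + a.1 2 = 0 ∧ b.1 0 + b.1 1 + b.1 2 = 1) ∨ (a.1 0 + a.1 1 + a.1 2 = 1 ∧ b.1 0 + b.1 1 + b.1 2 = 0)) ∧ ∃ i : Fin 3, a.1 + b.1 = Pi.single i 1)) then (criticalBeta 3 / 2) * (if a.1 0 + a.1 1 + a.1 2 = 0 ∨ b.1 0 + b.1 1 + b.1 2 = 0 then J else 1) else 0) (fun s => ∏ i, if h : z i ∈ box 3 L then spinAt (⟨z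 i, h⟩ : ↥(box 3 L)) s else 0)) J 2 ![x.1, y.1])) := by
  intro h1 h2 J hJ
  have key := iSup_tsum_eq_top_of_threshold h1.1 h1.2.1 h1.2.2 h2
    (fun J' hJ' L a b => seamCoupling_nonneg hJ') hJ.1 hJ.2.2
  exact key

end Summit.CriticalPhenomena.Ising3DConformalLimit.Cruxes.TwinTransparency.ReplicaMirror

end
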